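import Literature.AlgebraicGeometry.Resolution.BlowupAlgebraPresentation
import Mathlib.RingTheory.RegularLocalRing.Polynomial
import HarnessLib

/-!
# The graph chart of the blown-up quadric cone is an affine plane (crux `FrobeniusLadder.FRationalResolution`, line `Sketch`)

Stub `stub_chart_graph_sq` (worker U1) of the skeleton `Sketch` for crux
stmt-ResolutionOfSingularities-15317 (rung 4′ at the first singular member of the residual class: the
quadric cone `Q = {yz + x² = 0} ⊂ 𝔸³`, blown up in the origin `I = (x, y, z)`).

Let `R` be a `k`-algebra generated by `x, y, z` with `yz + x² = 0`, and let
`B = R[I/y] ⊆ R[1/y]` be the affine blowup algebra of `I = (x, y, z)` at `y`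
(`Literature.AlgebraicGeometry.Resolution.blowupAlgebra`, image model). Write `u = x/y ∈ B`
(`blowupAlgebra.gen`). We show that the `k`-algebra map

  `ψ : k[Y, X'] = MvPolynomial (Fin 2) k → B`, `Y ↦ y`, `X' ↦ u`

is bijective, so that `B ≅ k[Y, X']` is a regular ring (`IsRegularRing.of_ringEquiv`, Mathlib's
`MvPolynomial.isRegularRing_of_isRegularRing`):

* `chartGraphSq_aeval_surjective` — `B` is generated over `R` by the `r/y`, `r ∈ I`, and
  `r = a x + b y + c z` gives `r/y = a u + b + c (z/y)` with `z/y = -u²` (from `yz + x² = 0` in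
  `R[1/y]`); the elements of `R` are reached because `R = k[x, y, z]` (`hgen`) with `x = u · y`,
  `z = -u² · y`;
* `chartGraphSq_aeval_injective` — a test map `θ : R → k[Y, X'][1/Y]` with `θ y = Y`, `θ x = X'Y`
  extends to `R[1/y]` (`IsLocalization.Away.lift`, `θ y` is a unit), and the composite
  `k[Y, X'] → B ⊆ R[1/y] → k[Y, X'][1/Y]` is the localization map (it fixes `Y` and sends `X'` to
  `θ x · (θ y)⁻¹ = X'`), which is injective since `k[Y, X']` is a domain.
-/

set_option linter.dupNamespace false
-- single-problem summit: the doubled namespace component is forced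

noncomputable section

open Literature.AlgebraicGeometry.Resolution

namespace Summit.ResolutionOfSingularities.ResolutionOfSingularities.Theorems.FRationalResolution

variable {k R : Type} [Field k] [CommRing R] [Algebra k R]

/-- SURJECTIVITY OF THE CHART PARAMETRISATION. For a `k`-algebra `R` generated by `x, y, z` with
`yz + x² = 0`, the `k`-algebra map `k[Y, X'] → R[I/y]`, `Y ↦ y`, `X' ↦ x/y` (`I = (x, y, z)`) is
surjective: `R[I/y]` is generated over `R` by `x/y`, `y/y = 1`, `z/y = -(x/y)²`, and `R` by
`x = (x/y) y`, `y`, `z = -(x/y)² y` over `k`. -/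
theorem chartGraphSq_aeval_surjective (x y z : R) (hrel : y * z + x ^ 2 = 0)
    (hgen : Algebra.adjoin k {x, y, z} = ⊤) :
    Function.Surjective (MvPolynomial.aeval (R := k)
      ![algebraMap R (blowupAlgebra (Ideal.span {x, y, z}) y) y,
        blowupAlgebra.gen (Ideal.span {x, y, z}) y x (Ideal.subset_span (Set.mem_insert x _))]) := by
  set I : Ideal R := Ideal.span {x, y, z} with hI
  set ψ := MvPolynomial.aeval (R := k)
      ![algebraMap R (blowupAlgebra I y) y,
        blowupAlgebra.gen I y x (Ideal.subset_span (Set.mem_insert x _))] with hψ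
  -- the values of `ψ` on the variables, read in `R[1/y]`
  have hψ0 : (ψ (MvPolynomial.X 0) : Localization.Away y) = algebraMap R _ y := by
    rw [hψ, MvPolynomial.aeval_X]; rfl
  have hψ1 : (ψ (MvPolynomial.X 1) : Localization.Away y) =
      algebraMap R _ x * IsLocalization.Away.invSelf y := by
    rw [hψ, MvPolynomial.aeval_X]; rfl
  -- the two relations in `R[1/y]`: `y · (1/y) = 1` and `z/y = -(x/y)²`
  have h1 : algebraMap R (Localization.Away y) y * IsLocalization.Away.invSelf y = 1 :=
    IsLocalization.Away.mul_invSelf y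
  have hrelL : algebraMap R (Localization.Away y) y * algebraMap R _ z + algebraMap R _ x ^ 2 = 0 := by
    simpa using congrArg (algebraMap R (Localization.Away y)) hrel
  have h2 : algebraMap R (Localization.Away y) z * IsLocalization.Away.invSelf y +
      (algebraMap R _ x * IsLocalization.Away.invSelf y) ^ 2 = 0 := by
    linear_combination (-(algebraMap R _ z * IsLocalization.Away.invSelf y)) * h1 +
      IsLocalization.Away.invSelf y ^ 2 * hrelL
  -- every element of `R` is reached: `R = k[x, y, z]`, `x = (x/y) y`, `z = -(x/y)² y`
  have hR : ∀ r : R, ∃ q, ψ q = algebraMap R (blowupAlgebra I y) r := by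
    intro r
    have hr : r ∈ Algebra.adjoin k {x, y, z} := by rw [hgen]; exact Algebra.mem_top
    induction hr using Algebra.adjoin_induction with
    | mem s hs =>
      simp only [Set.mem_insert_iff, Set.mem_singleton_iff] at hs
      rcases hs with hs | hs | hs <;> rw [hs]
      · refine ⟨MvPolynomial.X 1 * MvPolynomial.X 0, Subtype.ext ?_⟩
        rw [map_mul, Subalgebra.coe_mul, hψ0, hψ1, Subalgebra.coe_algebraMap]
        exact div_mul_algebraMap y x
      · exact ⟨MvPolynomial.X 0, Subtype.ext (by rw [hψ0, Subalgebra.coe_algebraMap])⟩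
      · refine ⟨-(MvPolynomial.X 1 ^ 2 * MvPolynomial.X 0), Subtype.ext ?_⟩
        rw [map_neg, map_mul, map_pow, Subalgebra.coe_neg, Subalgebra.coe_mul, Subalgebra.coe_pow,
          hψ0, hψ1, Subalgebra.coe_algebraMap]
        linear_combination (-(algebraMap R _ y)) * h2 + algebraMap R _ z * h1
    | algebraMap c =>
      exact ⟨MvPolynomial.C c, by
        rw [MvPolynomial.algHom_C, IsScalarTower.algebraMap_apply k R (blowupAlgebra I y)]⟩
    | add r₁ r₂ _ _ h₁ h₂ =>
      obtain ⟨q₁, hq₁⟩ := h₁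
      obtain ⟨q₂, hq₂⟩ := h₂
      exact ⟨q₁ + q₂, by rw [map_add, map_add, hq₁, hq₂]⟩
    | mul r₁ r₂ _ _ h₁ h₂ =>
      obtain ⟨q₁, hq₁⟩ := h₁
      obtain ⟨q₂, hq₂⟩ := h₂
      exact ⟨q₁ * q₂, by rw [map_mul, map_mul, hq₁, hq₂]⟩
  -- every generator `r/y`, `r = a x + b y + c z ∈ I`, is reached: `r/y = a (x/y) + b - c (x/y)²`
  suffices h : ∀ b ∈ blowupAlgebra I y, ∃ q, (ψ q : Localization.Away y) = b by
    intro b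
    obtain ⟨q, hq⟩ := h b.1 b.2
    exact ⟨q, Subtype.ext hq⟩
  intro b hb
  induction hb using Algebra.adjoin_induction with
  | mem b hb =>
    obtain ⟨r, hr, rfl⟩ := hb
    obtain ⟨a, r', hr', rfl⟩ := Ideal.mem_span_insert.mp hr
    obtain ⟨b', c, rfl⟩ := Ideal.mem_span_pair.mp hr'
    obtain ⟨qa, hqa⟩ := hR a
    obtain ⟨qb, hqb⟩ := hR b'
    obtain ⟨qc, hqc⟩ := hR c
    refine ⟨qa * MvPolynomial.X 1 + qb - qc * MvPolynomial.X 1 ^ 2, ?_⟩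
    rw [map_sub, map_add, map_mul, map_mul, map_pow, hqa, hqb, hqc, Subalgebra.coe_sub,
      Subalgebra.coe_add, Subalgebra.coe_mul, Subalgebra.coe_mul, Subalgebra.coe_pow, hψ1,
      Subalgebra.coe_algebraMap, Subalgebra.coe_algebraMap, Subalgebra.coe_algebraMap]
    simp only [map_add, map_mul]
    linear_combination (-(algebraMap R _ b')) * h1 + (-(algebraMap R _ c)) * h2
  | algebraMap r =>
    obtain ⟨q, hq⟩ := hR r
    exact ⟨q, by rw [hq, Subalgebra.coe_algebraMap]⟩
  | add b₁ b₂ _ _ h₁ h₂ =>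
    obtain ⟨q₁, hq₁⟩ := h₁
    obtain ⟨q₂, hq₂⟩ := h₂
    exact ⟨q₁ + q₂, by rw [map_add, Subalgebra.coe_add, hq₁, hq₂]⟩
  | mul b₁ b₂ _ _ h₁ h₂ =>
    obtain ⟨q₁, hq₁⟩ := h₁
    obtain ⟨q₂, hq₂⟩ := h₂
    exact ⟨q₁ * q₂, by rw [map_mul, Subalgebra.coe_mul, hq₁, hq₂]⟩

/-- INJECTIVITY OF THE CHART PARAMETRISATION. If the `k`-algebra `R` admits a test map
`θ : R → k[Y, X'][1/Y]` with `θ y = Y`, `θ x = X'Y`, then `k[Y, X'] → R[I/y]`, `Y ↦ y`,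
`X' ↦ x/y` (`I = (x, y, z)`) is injective: `θ` extends to `θ' : R[1/y] → k[Y, X'][1/Y]`
(`θ y` is a unit), `θ'(x/y) = X'`, and `θ' ∘ (R[I/y] ⊆ R[1/y]) ∘ ψ` is the injective localization
map of the domain `k[Y, X']`. -/
theorem chartGraphSq_aeval_injective (x y z : R)
    (θ : R →ₐ[k] Localization.Away (MvPolynomial.X 0 : MvPolynomial (Fin 2) k))
    (hθy : θ y = algebraMap (MvPolynomial (Fin 2) k) _ (MvPolynomial.X 0))
    (hθx : θ x = algebraMap (MvPolynomial (Fin 2) k) _ (MvPolynomial.X 1 * MvPolynomial.X 0)) :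
    Function.Injective (MvPolynomial.aeval (R := k)
      ![algebraMap R (blowupAlgebra (Ideal.span {x, y, z}) y) y,
        blowupAlgebra.gen (Ideal.span {x, y, z}) y x (Ideal.subset_span (Set.mem_insert x _))]) := by
  set I : Ideal R := Ideal.span {x, y, z} with hI
  set ψ := MvPolynomial.aeval (R := k)
      ![algebraMap R (blowupAlgebra I y) y,
        blowupAlgebra.gen I y x (Ideal.subset_span (Set.mem_insert x _))] with hψ
  have hψ0 : (ψ (MvPolynomial.X 0) : Localization.Away y) = algebraMap R _ y := by
    rw [hψ, MvPolynomial.aeval_X]; rfl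
  have hψ1 : (ψ (MvPolynomial.X 1) : Localization.Away y) =
      algebraMap R _ x * IsLocalization.Away.invSelf y := by
    rw [hψ, MvPolynomial.aeval_X]; rfl
  -- `θ y = Y` is a unit of `k[Y, X'][1/Y]`, so `θ` extends to `θ' : R[1/y] → k[Y, X'][1/Y]`
  have hunit : IsUnit (θ.toRingHom y) := by
    rw [AlgHom.toRingHom_eq_coe, RingHom.coe_coe, hθy]
    exact IsLocalization.Away.algebraMap_isUnit _
  set θ' : Localization.Away y →+* Localization.Away (MvPolynomial.X 0 : MvPolynomial (Fin 2) k) :=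
    IsLocalization.Away.lift y hunit with hθ'
  have hθ'R : ∀ r : R, θ' (algebraMap R _ r) = θ r := fun r => IsLocalization.Away.lift_eq y hunit r
  -- `θ'(x/y) = X'`: multiply by the unit `θ' y = Y` and use `(x/y) · y = x`, `θ x = X'Y`
  have hθ'u : θ' (algebraMap R _ x * IsLocalization.Away.invSelf y) =
      algebraMap (MvPolynomial (Fin 2) k) _ (MvPolynomial.X 1) := by
    have h := congrArg θ' (div_mul_algebraMap y x)
    rw [map_mul θ', hθ'R, hθ'R, hθx, hθy, map_mul (algebraMap (MvPolynomial (Fin 2) k) _)] at h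
    exact (IsLocalization.Away.algebraMap_isUnit (MvPolynomial.X 0)).mul_left_inj.mp h
  -- the composite `k[Y, X'] → R[I/y] ⊆ R[1/y] → k[Y, X'][1/Y]` is the localization map
  have hcomp : (θ'.comp (blowupAlgebra I y).val.toRingHom).comp ψ.toRingHom =
      algebraMap (MvPolynomial (Fin 2) k)
        (Localization.Away (MvPolynomial.X 0 : MvPolynomial (Fin 2) k)) := by
    refine MvPolynomial.ringHom_ext (fun c => ?_) (Fin.forall_fin_two.mpr ⟨?_, ?_⟩)
    · change θ' ((ψ (MvPolynomial.C c) : Localization.Away y)) = _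
      rw [hψ, MvPolynomial.algHom_C, Subalgebra.coe_algebraMap,
        IsScalarTower.algebraMap_apply k R (Localization.Away y), hθ'R, AlgHom.commutes,
        IsScalarTower.algebraMap_apply k (MvPolynomial (Fin 2) k)
          (Localization.Away (MvPolynomial.X 0 : MvPolynomial (Fin 2) k)), MvPolynomial.algebraMap_eq]
    · change θ' ((ψ (MvPolynomial.X 0) : Localization.Away y)) = _
      rw [hψ0, hθ'R, hθy]
    · change θ' ((ψ (MvPolynomial.X 1) : Localization.Away y)) = _
      rw [hψ1, hθ'u]
  have hinj : Function.Injective ((θ'.comp (blowupAlgebra I y).val.toRingHom).comp ψ.toRingHom) := by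
    rw [hcomp]
    exact IsLocalization.injective (M := Submonoid.powers (MvPolynomial.X 0 : MvPolynomial (Fin 2) k))
      (S := Localization.Away (MvPolynomial.X 0 : MvPolynomial (Fin 2) k))
      (powers_le_nonZeroDivisors_of_noZeroDivisors (MvPolynomial.X_ne_zero _))
  intro p q hpq
  apply hinj
  change θ' ((ψ p : Localization.Away y)) = θ' ((ψ q : Localization.Away y))
  rw [hpq]

/-- GRAPH CHART OF THE QUADRIC CONE (stub `stub_chart_graph_sq` of the skeleton `Sketch`). `R` a
`k`-algebra generated by `x, y, z` with `yz + x² = 0`, and a test map `θ : R → k[Y, X'][1/Y]` with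
`θ y = Y`, `θ x = X'Y`, `θ z = −X'²Y`. Then the affine blowup algebra `R[I/y]`, `I = (x, y, z)`,
is a regular ring: `k[Y, X'] → R[I/y]`, `Y ↦ y`, `X' ↦ x/y` is a ring isomorphism
(`chartGraphSq_aeval_surjective`, `chartGraphSq_aeval_injective`) and `k[Y, X']` is regular. -/
theorem stub_chart_graph_sq (k R : Type) [Field k] [CommRing R] [Algebra k R] (x y z : R)
    (hrel : y * z + x ^ 2 = 0) (hgen : Algebra.adjoin k {x, y, z} = ⊤)
    (θ : R →ₐ[k] Localization.Away (MvPolynomial.X 0 : MvPolynomial (Fin 2) k))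
    (hθy : θ y = algebraMap (MvPolynomial (Fin 2) k) _ (MvPolynomial.X 0))
    (hθx : θ x = algebraMap (MvPolynomial (Fin 2) k) _ (MvPolynomial.X 1 * MvPolynomial.X 0))
    (hθz : θ z = -(algebraMap (MvPolynomial (Fin 2) k) _ (MvPolynomial.X 1 ^ 2 * MvPolynomial.X 0))) :
    IsRegularRing (blowupAlgebra (Ideal.span {x, y, z}) y) := by
  -- `θ z` is forced by `θ x`, `θ y` and `yz + x² = 0` (`y` becomes a unit); it is not needed below
  have _ := hθz
  exact IsRegularRing.of_ringEquiv (R := MvPolynomial (Fin 2) k)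
    (RingEquiv.ofBijective (MvPolynomial.aeval (R := k)
      ![algebraMap R (blowupAlgebra (Ideal.span {x, y, z}) y) y,
        blowupAlgebra.gen (Ideal.span {x, y, z}) y x (Ideal.subset_span (Set.mem_insert x _))])
      ⟨chartGraphSq_aeval_injective x y z θ hθy hθx, chartGraphSq_aeval_surjective x y z hrel hgen⟩)

end Summit.ResolutionOfSingularities.ResolutionOfSingularities.Theorems.FRationalResolution

end
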